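import Summits.BirchSwinnertonDyer.BirchSwinnertonDyer.Theorems.ThetaPartnerAtTwoSignedControlAtTwoPlusKimSignedUnion
import Literature.NumberTheory.EllipticCurves.Sprung2012.ColemanMaps
import HarnessLib

/-!
# Kobayashi's signed Kummer condition DESCENDS from `K_∞` to a finite layer: a layer class `c` whose restriction
# `h_m c` is Kummer-from-`B` over `K_∞·K_v` (`B ≤ E(K_m·K_v)`) is Kummer-from-`B` over `K_m·K_v`, as soon as
# `E(K_∞·K_v)` has no `p`-torsion — so LOC^ε@2 may be stated with the LEVEL-`∞` condition
# `localKummerOverOfEmb W 2 (ker κ) ι (⨆ₙ E^ε(ℚ_{2,n}))` (the object of INJ⁺@2's residue), KIM⁺ series part 5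

Route `ThetaPartnerAtTwo` (TP2; crux shared with `ResidualThetaTransportAtTwo`), crux K4 `SignedControlAtTwo`
(stmt-BirchSwinnertonDyer-20309), line `eulerchar` v4, stub `stub_plusKimNoFiniteSubmoduleTwo` (KIM⁺@2). Seat
`prover-bsd-wall-tp2-p3-w2` (width seat 2/3). Part 4 (`…PlusKimOfPrint`) displayed the `±`-local lift LOC^ε@2 in
"layer form" («`t − res y = h_n d` with `d` in the layer-`n` signed Kummer condition `𝒦^ε_n(w)`»). This file shows
that the LEVEL-`∞` Kummer form «`t − res y ∈ localKummerOverOfEmb W 2 (ker κ) (closureEmb ℚ_w) (⨆ₙ E^ε(ℚ_{2,n}·ℚ_w))`»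
— the same subgroup through which the sibling seat w3 phrases INJ⁺@2 (`signedSelmerInfty ≤ localKummerOverOfEmb …
(⨆ₙ E^ε)`, `…PlusLocalInjOfLift`) — already implies the layer form at a good supersingular `2`, because
`E(ℚ_∞·ℚ₂)` has no `2`-torsion (tree `SSFlatEC.eq_zero_of_mem_localTowerPointsOfEmb_of_two_nsmul`, Sprung 2012
Lemma 2.3 at `2`). TEMPLATE AND CREDIT for the cocycle bookkeeping: w3's `…SignedLocalInjEngine` (steps 0–1) and
x1b's `Rank1Residual.Additive.LevelBridge.exists_kummer_cocycle_of_mem_localKummerOverOfEmb_iSup_strictSigned`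
(the defect crossed homomorphism vanishing on `Gal(K̄_v/K_∞·K_v)`).

WHAT IS PROVED (namespace `…Theorems.SignedEC`):
* §1 `layer_mem_localKummerOverOfEmb_of_layerToInfty_mem` — any `K`, `p`, `κ`, `K`-field `E` with embedding `ι`,
  layer `m`, subgroup `B ≤ E(K_m·E)`: (NT) `E(K_∞·E)` has no `p`-torsion ∧ `h_m c ∈ localKummerOverOfEmb W p (ker κ) ι B`
  ⇒ `c ∈ localKummerOverOfEmb W p (κ⁻¹(p^mℤ_p)) ι B`. Proof: a cocycle `Φ` of `c` and the Kummer witness `(φ, Q, k)`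
  of `h_m c` differ on `Gal(K̄/K_∞)` by a coboundary `∂R₀`, `R₀ ∈ E[p^∞]`; with `Q₁ = Q − ι R₀`, `k' = k + m₀`
  (`p^{m₀} R₀ = 0`) the defect `u ↦ ι Φ(u|) − (u Q₁ − Q₁)` is a crossed homomorphism on `Gal(K̄_E/K_m·E)` vanishing
  on the normal subgroup `Gal(K̄_E/K_∞·E)`, hence `E(K_∞·E)`-valued, and `p`-power torsion (`p^{k'} Q₁ ∈ B` is
  `K_m·E`-rational), hence zero.
* §2 `exists_signedKummerLayer_of_layerToInfty_mem_localKummerOverOfEmb_iSup` — for Kobayashi's signed groups: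
  (NT) ∧ `s ∈ localKummerOverOfEmb W p (ker κ) (closureEmb E) (⨆ₙ E^ε(K_n·E))` ∧ `s = h_m c` ⇒ `s = h_N d` with
  `d ∈ 𝒦^ε_N(E)` for some `N ≥ m` (the union is directed, `signedLocalPointsOfEmb_mono`).
* The sequel `…PlusKimOfPrintKummer` (part 6) re-derives part 4's door / KIM / EC2 at `p = 2` with LOC^ε@2 displayed in
  the level-`∞` Kummer form (no `2`-torsion in `E(ℚ_∞·ℚ₂)` at a good supersingular `2` is a tree theorem).
HONEST FRAMING: THEOREMS ONLY (no definition, no named fact, no `sorry`), route-independent; nothing about any curve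
is asserted; closes no item; BSD is not proved by any of this.

References: [Kobayashi2003] Def. 1.1, Prop. 8.12; [Sprung2012] Lemma 2.3 (p. 1487); [BDKim2013] Props. 2.2–2.3,
Thm. 3.14, proof of Cor. 3.15; [GreenbergLNM1716] §3 pp. 85–86, §4 Lemma 4.7 (pp. 107–108);
[SerreGaloisCohomology1997] I.§5.8.
-/

set_option autoImplicit false
-- the Theorems namespace of this sub repeats the summit name by design (D-0017 nested layout)
set_option linter.dupNamespace false

noncomputable section

open scoped Classical NumberField

open NumberField IsDedekindDomain

universe u

namespace Summit.BirchSwinnertonDyer.BirchSwinnertonDyer.Theorems.SignedEC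

open Literature.NumberTheory.EllipticCurves Literature.NumberTheory.GaloisRepresentations
  WeierstrassCurve ZpExtension Literature.NumberTheory.EllipticCurves.Kobayashi2003
  Literature.NumberTheory.EllipticCurves.Sprung2012 Literature.NumberTheory.EllipticCurves.IwasawaDual
  Literature.NumberTheory.EllipticCurves.GreenbergVatsal2000

/-! ## §1 Descent of the Kummer condition cut out by `B ≤ E(K_m·E)` from `K_∞` to `K_m` -/

section Descent

variable {K : Type u} [Field K] (W : WeierstrassCurve K) {p : ℕ} [Fact p.Prime] (κ : ZpExtension K p)
  {E : Type u} [Field E] [Algebra K E]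

/-- No `p`-torsion ⟹ no `p`-power torsion in `E(K_∞·K_v)`. [folklore] -/
private theorem eq_zero_of_pow_smul_eq_zero_desc {ι : AlgebraicClosure K →ₐ[K] AlgebraicClosure E}
    (hnt : ∀ P ∈ localTowerPointsOfEmb κ ι W, p • P = 0 → P = 0)
    {m : ℕ} {P : localPoints W E} (hP : P ∈ localTowerPointsOfEmb κ ι W) (h : p ^ m • P = 0) :
    P = 0 := by
  induction m generalizing P with
  | zero => rwa [pow_zero, one_smul] at h
  | succ m ih =>
    have h1 : p ^ m • P ∈ localTowerPointsOfEmb κ ι W := AddSubgroup.nsmul_mem _ hP _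
    have h2 : p • (p ^ m • P) = 0 := by rw [← mul_smul, ← pow_succ']; exact h
    exact ih hP (hnt _ h1 h2)

/-- **The Kummer condition cut out by `B ≤ E(K_m·E)` descends from `K_∞·E` to `K_m·E`.** `K` a field, `W/K`,
`p` prime, `κ` a `ℤ_p`-extension, `E` a `K`-field with a `K`-embedding `ι : K̄ → K̄_E`, `m` a layer and
`B ≤ E(K_m·E)` (`localLayerPointsOfEmb κ ι W m`) any subgroup. If `E(K_∞·E)` (`localTowerPointsOfEmb`) has no
`p`-torsion and the restriction `h_m c ∈ H¹(K_∞, E[p^∞])` of a layer class `c ∈ H¹(K_m, E[p^∞])` lies in the Kummer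
condition cut out by `B` at level `Gal(K̄/K_∞)` (`localKummerOverOfEmb W p (ker κ) ι B`: its restriction to
`Gal(K̄_E/K_∞·E)` is the Kummer cocycle `τ ↦ τQ − Q` of a point `Q` with `p^k Q ∈ B`), then `c` itself lies in the
Kummer condition cut out by `B` at level `Gal(K̄/K_m)`. Any cocycle `Φ` of `c` agrees with `∂Q₁` (`Q₁ = Q − ι R₀`,
`R₀ ∈ E[p^∞]` the coboundary between the two representatives) on `Gal(K̄_E/K_∞·E)`; the defect is a crossed
homomorphism on `Gal(K̄_E/K_m·E)` vanishing on that normal subgroup, so `E(K_∞·E)`-valued; it is `p`-power torsion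
(`p^{k'} Q₁ ∈ B` is fixed by `Gal(K̄_E/K_m·E)`), hence `0`. [cite: Kobayashi2003, Def. 1.1]
[cite: GreenbergLNM1716, §3 pp. 85–86] [cite: SerreGaloisCohomology1997, I.§5.8] -/
theorem layer_mem_localKummerOverOfEmb_of_layerToInfty_mem
    (ι : AlgebraicClosure K →ₐ[K] AlgebraicClosure E)
    (hnt : ∀ P ∈ localTowerPointsOfEmb κ ι W, p • P = 0 → P = 0)
    {m : ℕ} (B : AddSubgroup (localPoints W E)) (hB : B ≤ localLayerPointsOfEmb κ ι W m)
    {c : W.subgroupH1 p (κ.layerSubgroup m)}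
    (hc : W.layerToInfty κ m c ∈ localKummerOverOfEmb W p κ.kerSubgroup ι B) :
    c ∈ localKummerOverOfEmb W p (κ.layerSubgroup m) ι B := by
  -- notation and generalities
  set M : AddSubgroup (localPoints W E) := localTowerPointsOfEmb κ ι W with hM
  have hMfix : ∀ {P : localPoints W E}, P ∈ M →
      ∀ τ : Field.absoluteGaloisGroup E, τ ∈ localSubgroupOfEmb κ.kerSubgroup ι → τ • P = P :=
    fun {P} hP ↦ (mem_localTowerPointsOfEmb_iff κ ι W P).1 hP
  have hconj : ∀ (σ τ : Field.absoluteGaloisGroup E), τ ∈ localSubgroupOfEmb κ.kerSubgroup ι →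
      σ⁻¹ * τ * σ ∈ localSubgroupOfEmb κ.kerSubgroup ι := by
    intro σ τ hτ
    rw [mem_localSubgroupOfEmb_iff] at hτ ⊢
    rw [map_mul, map_mul, map_inv]
    exact κ.kerSubgroup_normal.conj_mem' _ hτ _
  have hGm : ∀ {u : Field.absoluteGaloisGroup E}, u ∈ localSubgroupOfEmb (κ.layerSubgroup m) ι →
      resGalOfEmb ι u ∈ κ.layerSubgroup m := fun {u} hu ↦ (mem_localSubgroupOfEmb_iff _ ι u).1 hu
  have hG_inf_le : ∀ {τ : Field.absoluteGaloisGroup E}, τ ∈ localSubgroupOfEmb κ.kerSubgroup ι →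
      τ ∈ localSubgroupOfEmb (κ.layerSubgroup m) ι := fun {τ} hτ ↦ by
    rw [mem_localSubgroupOfEmb_iff] at hτ ⊢
    exact κ.kerSubgroup_le_layerSubgroup m hτ
  -- Step 0: a cocycle `Φ` of `c`; its local values on `G_m = Gal(K̄_E/K_m·E)`
  obtain ⟨Φ, rfl⟩ := oneCocycleClass_surjective (discreteTopRep (κ.layerSubgroup m) (W.geomPrimaryTorsion p)) c
  obtain ⟨f, hf⟩ : ∃ f : ∀ u : Field.absoluteGaloisGroup E, u ∈ localSubgroupOfEmb (κ.layerSubgroup m) ι →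
      localPoints W E, ∀ u hu, f u hu =
      pointsMapOfEmb W ι ((Φ.1 ⟨resGalOfEmb ι u, hGm hu⟩ : W.geomPrimaryTorsion p) : W.geomPoints) :=
    ⟨_, fun _ _ ↦ rfl⟩
  -- cocycle identity for `f`
  have hfmul : ∀ (σ τ : Field.absoluteGaloisGroup E) (hσ : σ ∈ localSubgroupOfEmb (κ.layerSubgroup m) ι)
      (hτ : τ ∈ localSubgroupOfEmb (κ.layerSubgroup m) ι),
      f (σ * τ) (mul_mem hσ hτ) = f σ hσ + σ • f τ hτ := by
    intro σ τ hσ hτ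
    have hst : (⟨resGalOfEmb ι (σ * τ), hGm (mul_mem hσ hτ)⟩ : κ.layerSubgroup m) =
        ⟨resGalOfEmb ι σ, hGm hσ⟩ * ⟨resGalOfEmb ι τ, hGm hτ⟩ := Subtype.ext (map_mul _ _ _)
    have h := Φ.2 ⟨resGalOfEmb ι σ, hGm hσ⟩ ⟨resGalOfEmb ι τ, hGm hτ⟩
    rw [hf (σ * τ) (mul_mem hσ hτ), hf σ hσ, hf τ hτ, hst, h, AddSubgroup.coe_add, map_add,
      discreteTopRep_ρ_apply, Subgroup.smul_def, primaryComponent.coe_smul, pointsMapOfEmb_smul]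
  -- the values of `Φ` (hence of `f`) are `p`-power torsion
  have hftors : ∀ u hu, ∃ N : ℕ, p ^ N • f u hu = 0 := fun u hu ↦ by
    obtain ⟨N, hN⟩ := AddCommGroup.mem_primaryComponent.mp (Φ.1 ⟨resGalOfEmb ι u, hGm hu⟩).2
    refine ⟨N, ?_⟩
    rw [hf u hu, ← map_nsmul, hN, map_zero]
  -- Step 1: unpack the Kummer condition of `h_m c` and absorb the coboundary between the two representatives
  obtain ⟨φ, Q, k, hφ, hQB, hcob⟩ := hc
  have hres : W.layerToInfty κ m (oneCocycleClass _ Φ) =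
      oneCocycleClass _ (contOneCocycles.pullback (subgroupInclusion (κ.kerSubgroup_le_layerSubgroup m))
        (resHomOfEquivariant (subgroupInclusion (κ.kerSubgroup_le_layerSubgroup m))
          (AddMonoidHom.id (W.geomPrimaryTorsion p)) (fun _ _ ↦ rfl)) Φ) :=
    map_oneCocycleClass _ _ _ Φ
  rw [hres, ← sub_eq_zero, ← oneCocycleClass_sub, oneCocycleClass_eq_zero_iff] at hφ
  obtain ⟨R₀, hR₀⟩ := hφ
  -- `φ h = Φ h + (h R₀ − R₀)` for `h ∈ ker κ`
  have hφΦ : ∀ h : κ.kerSubgroup, (φ.1 h : W.geomPrimaryTorsion p) =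
      Φ.1 ⟨(h : Field.absoluteGaloisGroup K), κ.kerSubgroup_le_layerSubgroup m h.2⟩ +
        ((h : Field.absoluteGaloisGroup K) • R₀ - R₀) := by
    intro h
    have hpb : (contOneCocycles.pullback (subgroupInclusion (κ.kerSubgroup_le_layerSubgroup m))
        (resHomOfEquivariant (subgroupInclusion (κ.kerSubgroup_le_layerSubgroup m))
          (AddMonoidHom.id (W.geomPrimaryTorsion p)) (fun _ _ ↦ rfl)) Φ).1 h =
        Φ.1 ⟨(h : Field.absoluteGaloisGroup K), κ.kerSubgroup_le_layerSubgroup m h.2⟩ := by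
      rw [contOneCocycles.pullback_apply]; rfl
    have h1 := hR₀ h
    rw [Submodule.coe_sub, ContinuousMap.sub_apply, hpb, sub_eq_iff_eq_add, discreteTopRep_ρ_apply,
      Subgroup.smul_def] at h1
    rw [h1, add_comm]
  -- a power of `p` killing `R₀`
  obtain ⟨m₀, hm₀⟩ : ∃ m₀ : ℕ, p ^ m₀ • R₀ = 0 := by
    obtain ⟨m₀, hm⟩ := AddCommGroup.mem_primaryComponent.mp R₀.2
    exact ⟨m₀, Subtype.ext (by rw [AddSubmonoidClass.coe_nsmul, hm, ZeroMemClass.coe_zero])⟩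
  -- the corrected point `Q₁`, exponent `k' = k + m₀`, `x' = p^{k'} Q₁ = p^{m₀} (p^k Q) ∈ B`
  set R₀' : localPoints W E := pointsMapOfEmb W ι ((R₀ : W.geomPrimaryTorsion p) : W.geomPoints) with hR₀'
  have hR₀'tors : p ^ m₀ • R₀' = 0 := by
    rw [hR₀', ← map_nsmul, ← AddSubmonoidClass.coe_nsmul, hm₀, ZeroMemClass.coe_zero, map_zero]
  set Q₁ : localPoints W E := Q - R₀' with hQ₁
  set k' : ℕ := k + m₀ with hk'
  have hx'eq : p ^ k' • Q₁ = p ^ m₀ • (p ^ k • Q) := by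
    have e1 : p ^ k' • R₀' = 0 := by rw [hk', pow_add, mul_smul, hR₀'tors, smul_zero]
    rw [hQ₁, smul_sub, e1, sub_zero, hk', pow_add, mul_comm, mul_smul]
  have hx'B : p ^ k' • Q₁ ∈ B := by rw [hx'eq]; exact AddSubgroup.nsmul_mem _ hQB _
  -- `f τ = τ Q₁ − Q₁` on `G_∞ = Gal(K̄_E/K_∞·E)`
  have hfcob : ∀ (τ : Field.absoluteGaloisGroup E) (hτ : τ ∈ localSubgroupOfEmb κ.kerSubgroup ι),
      f τ (hG_inf_le hτ) = τ • Q₁ - Q₁ := by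
    intro τ hτ
    have h1 := hcob ⟨τ, hτ⟩
    change pointsMapOfEmb W ι _ = τ • Q - Q at h1
    have h2 := hφΦ (resGalSubgroupOfEmb κ.kerSubgroup ι ⟨τ, hτ⟩)
    have h3 : f τ (hG_inf_le hτ) = pointsMapOfEmb W ι ((Φ.1
        ⟨((resGalSubgroupOfEmb κ.kerSubgroup ι ⟨τ, hτ⟩ : κ.kerSubgroup) : Field.absoluteGaloisGroup K),
          κ.kerSubgroup_le_layerSubgroup m (resGalSubgroupOfEmb κ.kerSubgroup ι ⟨τ, hτ⟩).2⟩ :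
        W.geomPrimaryTorsion p) : W.geomPoints) := hf τ (hG_inf_le hτ)
    have h4 : Φ.1 ⟨((resGalSubgroupOfEmb κ.kerSubgroup ι ⟨τ, hτ⟩ : κ.kerSubgroup) :
          Field.absoluteGaloisGroup K),
          κ.kerSubgroup_le_layerSubgroup m (resGalSubgroupOfEmb κ.kerSubgroup ι ⟨τ, hτ⟩).2⟩ =
        φ.1 (resGalSubgroupOfEmb κ.kerSubgroup ι ⟨τ, hτ⟩) -
          (((resGalSubgroupOfEmb κ.kerSubgroup ι ⟨τ, hτ⟩ : κ.kerSubgroup) :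
            Field.absoluteGaloisGroup K) • R₀ - R₀) := by
      rw [h2]; abel
    rw [h3, h4, AddSubgroup.coe_sub, map_sub, h1, AddSubgroup.coe_sub, map_sub,
      primaryComponent.coe_smul, resGalSubgroupOfEmb_apply_coe, pointsMapOfEmb_smul, hQ₁, smul_sub]
    abel
  -- Step 2: the defect `f u − (u Q₁ − Q₁)` on `G_m` is `E(K_∞·E)`-valued …
  have hdefM : ∀ (u : Field.absoluteGaloisGroup E) (hu : u ∈ localSubgroupOfEmb (κ.layerSubgroup m) ι),
      f u hu - (u • Q₁ - Q₁) ∈ M := by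
    intro u hu
    rw [hM, mem_localTowerPointsOfEmb_iff]
    intro τ hτ
    have hτ' := hconj u τ hτ
    have e1 : f (τ * u) (mul_mem (hG_inf_le hτ) hu) = f τ (hG_inf_le hτ) + τ • f u hu :=
      hfmul τ u (hG_inf_le hτ) hu
    have e2 : f (τ * u) (mul_mem (hG_inf_le hτ) hu) = f u hu + u • f (u⁻¹ * τ * u) (hG_inf_le hτ') := by
      have e := hfmul u (u⁻¹ * τ * u) hu (hG_inf_le hτ')
      have huu : u * (u⁻¹ * τ * u) = τ * u := by group
      simp only [huu] at e
      exact e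
    rw [hfcob τ hτ] at e1
    rw [hfcob _ hτ', smul_sub, ← mul_smul, show u * (u⁻¹ * τ * u) = τ * u by group, mul_smul] at e2
    have key := e1.symm.trans e2
    rw [smul_sub, smul_sub]
    calc τ • f u hu - (τ • u • Q₁ - τ • Q₁)
        = (τ • Q₁ - Q₁ + τ • f u hu) - τ • u • Q₁ + Q₁ := by abel
      _ = (f u hu + (τ • u • Q₁ - u • Q₁)) - τ • u • Q₁ + Q₁ := by rw [key]
      _ = f u hu - (u • Q₁ - Q₁) := by abel
  -- … and `p`-power torsion (`u` fixes `p^{k'} Q₁ ∈ B ≤ E(K_m·E)`), hence zero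
  have hdef0 : ∀ (u : Field.absoluteGaloisGroup E) (hu : u ∈ localSubgroupOfEmb (κ.layerSubgroup m) ι),
      f u hu = u • Q₁ - Q₁ := by
    intro u hu
    obtain ⟨N, hN⟩ := hftors u hu
    have hux : u • (p ^ k' • Q₁) = p ^ k' • Q₁ :=
      (mem_localLayerPointsOfEmb_iff κ ι W m _).mp (hB hx'B) u hu
    have htors : p ^ (N + k') • (f u hu - (u • Q₁ - Q₁)) = 0 := by
      have e1 : p ^ k' • (u • Q₁ - Q₁) = 0 := by
        rw [smul_sub, smul_comm (p ^ k') u Q₁, hux, sub_self]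
      rw [pow_add, mul_smul, smul_sub (p ^ k'), e1, sub_zero, smul_comm, hN, smul_zero]
    exact sub_eq_zero.mp (eq_zero_of_pow_smul_eq_zero_desc W κ hnt (hdefM u hu) htors)
  -- conclusion: the witness `(Φ, Q₁, k')` at level `K_m`
  refine ⟨Φ, Q₁, k', rfl, hx'B, fun τ ↦ ?_⟩
  have h := hdef0 (τ : Field.absoluteGaloisGroup E) τ.2
  rw [hf _ τ.2] at h
  exact h

end Descent

/-! ## §2 Kobayashi's signed groups: level-`∞` Kummer membership ⇒ a layer class in `𝒦^ε_N` -/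

section Signed

open Summit.BirchSwinnertonDyer.Rank1Residual.Additive
  Summit.BirchSwinnertonDyer.BirchSwinnertonDyer.Theorems.FineSelmerLeSignedSelmer

variable {K : Type u} [Field K] [NumberField K] (W : WeierstrassCurve K) {p : ℕ} [Fact p.Prime]
  (κ : ZpExtension K p) (E : Type u) [Field E] [Algebra K E] (ε : ℤˣ)

omit [NumberField K] in
/-- **A layer class whose restriction lies in the level-`∞` Kummer condition cut out by `⋃ₙ E^ε(K_n·E)` is, at a
higher layer, in Kobayashi's layer condition `𝒦^ε_N(E)`** (no `p`-torsion in `E(K_∞·E)`): the witness point lives in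
one `E^ε(K_{n₁}·E)` (the union is directed, `signedLocalPointsOfEmb_mono`), and at `N = max m n₁` §1 applies with
`B = E^ε(K_N·E) ≤ E(K_N·E)`. [cite: Kobayashi2003, Def. 1.1 and Prop. 8.12 (proof, p. 18)] -/
theorem exists_signedKummerLayer_of_layerToInfty_mem_localKummerOverOfEmb_iSup
    (hnt : ∀ P ∈ localTowerPointsOfEmb κ (closureEmb (K := K) E) W, p • P = 0 → P = 0)
    {m : ℕ} (c : W.subgroupH1 p (κ.layerSubgroup m))
    (hc : W.layerToInfty κ m c ∈ localKummerOverOfEmb W p κ.kerSubgroup (closureEmb (K := K) E)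
      (⨆ n, signedLocalPoints κ E W ε n)) :
    ∃ (N : ℕ) (d : W.subgroupH1 p (κ.layerSubgroup N)),
      d ∈ localKummerOverOfEmb W p (κ.layerSubgroup N) (closureEmb (K := K) E) (signedLocalPoints κ E W ε N) ∧
      W.layerToInfty κ N d = W.layerToInfty κ m c := by
  obtain ⟨φ, Q, k, hφ, hQ, hcob⟩ := hc
  obtain ⟨n₁, hn₁⟩ := (AddSubgroup.mem_iSup_of_directed
    (signedLocalPointsOfEmb_mono κ (closureEmb (K := K) E) W ε).directed_le).mp hQ
  refine ⟨max m n₁, W.resOfLe p (κ.layerSubgroup_antitone (le_max_left m n₁)) c, ?_,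
    layerToInfty_resOfLe_layer W κ (le_max_left m n₁) c⟩
  refine layer_mem_localKummerOverOfEmb_of_layerToInfty_mem W κ (closureEmb (K := K) E) hnt
    (signedLocalPoints κ E W ε (max m n₁)) (signedLocalPointsOfEmb_le κ _ W ε _) ?_
  rw [layerToInfty_resOfLe_layer W κ (le_max_left m n₁) c]
  exact ⟨φ, Q, k, hφ, signedLocalPointsOfEmb_mono κ (closureEmb (K := K) E) W ε (le_max_right m n₁) hn₁, hcob⟩

/-- **Membership in the level-`∞` signed Kummer condition ⇒ a restricted layer class in `𝒦^ε_N(E)`**: for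
`s ∈ H¹(K_∞, E[p^∞])` with `s ∈ localKummerOverOfEmb W p (ker κ) (closureEmb E) (⨆ₙ E^ε(K_n·E))` (and no `p`-torsion
in `E(K_∞·E)`), `s = h_N d` for some layer `N` and `d ∈ 𝒦^ε_N(E)` — every class comes from a layer
(`exists_layerToInfty_eq`), then the previous lemma. This converts the LEVEL-`∞` form of LOC^ε into the layer form
consumed by parts 3–4. [cite: Kobayashi2003, Def. 1.1] [cite: GreenbergLNM1716, §3 Lemma 3.2 (p. 86)] -/
theorem exists_signedKummerLayer_of_mem_localKummerOverOfEmb_iSup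
    (hnt : ∀ P ∈ localTowerPointsOfEmb κ (closureEmb (K := K) E) W, p • P = 0 → P = 0)
    {s : W.subgroupH1 p κ.kerSubgroup}
    (hs : s ∈ localKummerOverOfEmb W p κ.kerSubgroup (closureEmb (K := K) E) (⨆ n, signedLocalPoints κ E W ε n)) :
    ∃ (N : ℕ) (d : W.subgroupH1 p (κ.layerSubgroup N)),
      d ∈ localKummerOverOfEmb W p (κ.layerSubgroup N) (closureEmb (K := K) E) (signedLocalPoints κ E W ε N) ∧
      W.layerToInfty κ N d = s := by
  obtain ⟨m, c, rfl⟩ := FineSelmerLeSignedSelmer.exists_layerToInfty_eq W κ s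
  exact exists_signedKummerLayer_of_layerToInfty_mem_localKummerOverOfEmb_iSup W κ E ε hnt c hs

omit [NumberField K] in
/-- The level-`∞` signed Kummer condition refines the classical local condition over `K_∞` at the chosen place
(`localKummerOverOfEmb ≤ localKerOverOfEmb`, Kobayashi: «`Sel^± ⊆ Sel`»). [cite: Kobayashi2003, Def. 1.1] -/
theorem mem_localKerOver_of_mem_localKummerOverOfEmb_iSup {s : W.subgroupH1 p κ.kerSubgroup}
    (hs : s ∈ localKummerOverOfEmb W p κ.kerSubgroup (closureEmb (K := K) E) (⨆ n, signedLocalPoints κ E W ε n)) :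
    s ∈ W.localKerOver p κ.kerSubgroup E := by
  rw [localKerOver_eq_ofEmb]
  exact localKummerOverOfEmb_le_localKerOverOfEmb _ hs

end Signed


end Summit.BirchSwinnertonDyer.BirchSwinnertonDyer.Theorems.SignedEC

end
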